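import Literature.MathematicalPhysics.QuantumFieldTheory.BalabanImbrieJaffe1984to88.BIJ88PairingAllOrders5133

/-!
# `BalabanImbrieJaffe1984to88.BIJ88CoupledPairings305` — T. Bałaban, J. Imbrie, A. Jaffe, *Effective action and cluster properties of the
abelian Higgs model*, Commun. Math. Phys. **114** (1988) 257–315 [BalabanImbrieJaffe1988]: p. 305 [PDF 49] L23–31 (Sect. 5.13), verbatim:
*"To calculate the s-derivatives, note that the first derivative produces a term … Subsequent derivatives either hit factors s_{i′} already
pulled down or bring new terms down with new truncations. After all derivatives are performed, we set the remaining s_j to zero, so only terms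
with no s_j multiplying them survive. The result is … Σ_{pairings p = {p_γ} of Γ} …"* and p. 307 [PDF 51] L22–25: *"Estimating the sums over
S_γ, S_δ, and the sums in the cluster expansion leads to combinatoric factors exp((e^β(L^kε/ε₀)^{1/4−α})^{β′}|X_α|), β′ > 0"* — **THE NUMBER OF
VERTEX STRUCTURES WITH COUPLED PAIRS IS EXPONENTIAL IN THE NUMBER OF CUBES**.

The master bound of the located (5.14.4) (`BIJ88LocatedActivityBound309.abs_actIn_le_master`) sums over the vertex structures
`σ ∈ smallParts X″` (`BIJ88PairingAllOrders5133.smallParts`: the set partitions of `X″` into blocks of one or two cubes — print's *"pairings"*);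
a pair block `{i, i′}` carries the vertex `⟨□_iΦ, Δ□_{i′}Φ⟩`, which vanishes unless `Δ` couples the two cubes
(`BIJ88TrainDecayLetter309.prec_inv_mul_wker_eq_zero_of_empty`).  THIS FILE counts the vertex structures whose pair blocks are coupled: if
every cube is coupled to at most `D` cubes of `X″`, their number is at most `(D+1)^{|X″|}` — one of the *"combinatoric factors"* `exp(O(1)|X″|)` of
the SIZE-FREE assembly (GAPS G-C2-p36-10 ADDENDUM 7, step 6 of HOME `lit-balaban-p36/ASSEMBLY-PLAN.md`).
* `blockOf` is NOT a definition: the block of `i` is written `(σ.filter (i ∈ ·)).biUnion id`; `blockOf_mem`, `mem_blockOf`, `blockOf_eq_of_mem`;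
* `injOn_blockOf` — a set partition is determined by the blocks of its elements;
* **`card_smallParts_coupled_le`** — `#{σ ∈ smallParts X : every pair block is coupled} ≤ (D+1)^{|X|}`.

statement-level skeleton of published theorems with citation tags; proofs where landed; nothing here is a claim about the Yang–Mills mass gap

PDF held: `paper:balaban1988-cmp114-bij-abelian-higgs-effective-action` p. 305 (p0049 L14–36) and p. 307 (p0051 L22–25) re-read this session as
text.

CITATION HEADER (lean-in-tree rule).  Part of the lit-balaban TYPED SKELETON (HOME `run/shared/lean/pub/lit-balaban/`), Phase 2, seat p36
(gen 23, unit `lit-balaban-p36`); rows **C2.Eq5.14.3-5.14.4** (member: size-free road, assembly step 6) and C2.Eq5.13.3-5.13.4 (member) of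
`HOME/lit-balaban-r16/ROWS-C2-part2.md` (owner r16, referee ref-5).  Theorem-only (finite combinatorics on the tree's `smallParts`); no definitions,
no `Prop` facts; axioms standard.  HONEST SCOPE: a count; the coupling degree `D` is the reader's letter (`3^d − 1` for cubes of ℤ^d).  NOT summit
progress; NOT continuum; NOT Clay.
-/

namespace Literature.MathematicalPhysics.QuantumFieldTheory.BalabanImbrieJaffe1984to88.BIJ88CoupledPairings305

open Finset
open scoped BigOperators
open Literature.Probability.LatticeModels (setPartitions IsSetPartition mem_setPartitions)
open BIJ88PairingAllOrders5133 (smallParts mem_smallParts)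

variable {I : Type} [DecidableEq I]

/-! ## §1  The block of an element -/

/-- in a set partition of `X`, the union of the blocks containing `i ∈ X` is a block containing `i` (THE block of `i`). [folklore]
[cite: BalabanImbrieJaffe1988, §5.13 p.305 L23–31] -/
theorem blockOf_mem {X : Finset I} {σ : Finset (Finset I)} (hσ : IsSetPartition X σ) {i : I} (hi : i ∈ X) :
    (σ.filter fun B => i ∈ B).biUnion id ∈ σ ∧ i ∈ (σ.filter fun B => i ∈ B).biUnion id := by
  obtain ⟨P, hP, hiP⟩ := hσ.exists_mem hi
  have h1 : (σ.filter fun B => i ∈ B) = {P} := by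
    ext Q
    simp only [mem_filter, mem_singleton]
    exact ⟨fun h => hσ.eq_of_mem h.1 hP h.2 hiP, fun h => h ▸ ⟨hP, hiP⟩⟩
  rw [h1, singleton_biUnion, id]
  exact ⟨hP, hiP⟩

/-- the block of `i` is the block `P ∋ i`. [folklore] [cite: BalabanImbrieJaffe1988, §5.13 p.305 L23–31] -/
theorem blockOf_eq_of_mem {X : Finset I} {σ : Finset (Finset I)} (hσ : IsSetPartition X σ) {i : I} {P : Finset I} (hP : P ∈ σ)
    (hiP : i ∈ P) : (σ.filter fun B => i ∈ B).biUnion id = P := by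
  have h1 : (σ.filter fun B => i ∈ B) = {P} := by
    ext Q
    simp only [mem_filter, mem_singleton]
    exact ⟨fun h => hσ.eq_of_mem h.1 hP h.2 hiP, fun h => h ▸ ⟨hP, hiP⟩⟩
  rw [h1, singleton_biUnion, id]

/-- **a set partition is determined by the blocks of its elements**: `σ ↦ (i ↦ block of i)` is injective on `setPartitions X`. [folklore]
[cite: BalabanImbrieJaffe1988, §5.13 p.305 L23–31] -/
theorem injOn_blockOf (X : Finset I) :
    Set.InjOn (fun (σ : Finset (Finset I)) (i : ↥X) => (σ.filter fun B => i.1 ∈ B).biUnion id) (setPartitions X : Set (Finset (Finset I))) := by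
  intro σ hσ σ' hσ' h
  rw [mem_coe, mem_setPartitions] at hσ hσ'
  have key : ∀ {σ σ' : Finset (Finset I)}, IsSetPartition X σ → IsSetPartition X σ' →
      (fun i : ↥X => (σ.filter fun B => i.1 ∈ B).biUnion id) = (fun i : ↥X => (σ'.filter fun B => i.1 ∈ B).biUnion id) → σ ⊆ σ' := by
    intro σ σ' hσ hσ' h B hB
    obtain ⟨i, hiB⟩ := hσ.nonempty_of_mem hB
    have hiX : i ∈ X := hσ.subset hB hiB
    have h1 := congr_fun h ⟨i, hiX⟩
    simp only at h1
    rw [blockOf_eq_of_mem hσ hB hiB] at h1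
    rw [h1]
    exact (blockOf_mem hσ' hiX).1
  exact Subset.antisymm (key hσ hσ' h) (key hσ' hσ h.symm)

/-! ## §2  The count -/

/-- **THE VERTEX STRUCTURES WITH COUPLED PAIRS NUMBER AT MOST `(D+1)^{|X|}`**: if every cube `i ∈ X` is coupled (`adj i ·`) to at most `D` cubes of
`X`, the set partitions of `X` into single cubes and COUPLED pairs are at most `(D+1)^{|X|}` — each cube's block is `{i}` or `{i, i′}` with `i′`
one of its `≤ D` partners (print p. 305: the pairings of the `s`-derivatives; p. 307 L22–25: *"combinatoric factors"* exponential in `|X_α|`).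
[cite: BalabanImbrieJaffe1988, §5.13 p.305 L23–31, p.307 L22–25] -/
theorem card_smallParts_coupled_le (X : Finset I) (adj : I → I → Prop) [DecidableRel adj] {D : ℕ}
    (hdeg : ∀ i ∈ X, (X.filter fun l => adj i l).card ≤ D) :
    ((smallParts X).filter fun σ => ∀ B ∈ σ, ∀ i ∈ B, ∀ l ∈ B, i ≠ l → adj i l).card ≤ (D + 1) ^ X.card := by
  classical
  -- the range: the block of `i` is `{i}` or `{i,l}` with `l ∈ X`, `adj i l`
  set R : ↥X → Finset (Finset I) := fun i => insert {i.1} ((X.filter fun l => adj i.1 l).image fun l => {i.1, l}) with hR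
  have hRcard : ∀ i : ↥X, (R i).card ≤ D + 1 := fun i =>
    (card_insert_le _ _).trans (Nat.add_le_add_right (card_image_le.trans (hdeg i.1 i.2)) 1)
  have hmaps : ∀ σ ∈ (smallParts X).filter (fun σ => ∀ B ∈ σ, ∀ i ∈ B, ∀ l ∈ B, i ≠ l → adj i l),
      (fun i : ↥X => (σ.filter fun B => i.1 ∈ B).biUnion id) ∈ Fintype.piFinset R := by
    intro σ hσ
    rw [mem_filter, mem_smallParts] at hσ
    obtain ⟨⟨hsp, h2⟩, hadj⟩ := hσ
    rw [Fintype.mem_piFinset]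
    intro i
    obtain ⟨hB, hiB⟩ := blockOf_mem hsp i.2
    set B := (σ.filter fun B => i.1 ∈ B).biUnion id with hBdef
    rw [hR, mem_insert, mem_image]
    have hcard := h2 B hB
    by_cases h1 : B.card = 1
    · left
      obtain ⟨a, ha⟩ := card_eq_one.1 h1
      rw [ha, mem_singleton] at hiB
      rw [ha, hiB]
    · right
      have hc2 : B.card = 2 := by
        have h0 : B.card ≠ 0 := card_ne_zero.2 ⟨i.1, hiB⟩
        omega
      obtain ⟨a, b, hab, hB2⟩ := card_eq_two.1 hc2
      have hi' : i.1 = a ∨ i.1 = b := by simpa [hB2] using hiB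
      -- the partner `l` of `i`
      obtain ⟨l, hl, hil, hBl⟩ : ∃ l, l ∈ B ∧ i.1 ≠ l ∧ B = {i.1, l} := by
        rcases hi' with h | h
        · exact ⟨b, by simp [hB2], by rw [h]; exact hab, by rw [hB2, h]⟩
        · exact ⟨a, by simp [hB2], by rw [h]; exact hab.symm, by rw [hB2, h, pair_comm]⟩
      refine ⟨l, mem_filter.2 ⟨hsp.subset hB hl, hadj B hB i.1 hiB l hl hil⟩, hBl.symm⟩
  calc ((smallParts X).filter fun σ => ∀ B ∈ σ, ∀ i ∈ B, ∀ l ∈ B, i ≠ l → adj i l).card ≤ (Fintype.piFinset R).card :=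
        card_le_card_of_injOn _ hmaps ((injOn_blockOf X).mono fun σ hσ => by
          have h := (mem_filter.1 (mem_coe.1 hσ)).1
          rw [mem_smallParts] at h
          exact mem_coe.2 (mem_setPartitions.2 h.1))
    _ = ∏ i : ↥X, (R i).card := Fintype.card_piFinset R
    _ ≤ ∏ _i : ↥X, (D + 1) := prod_le_prod' fun i _ => hRcard i
    _ = (D + 1) ^ X.card := by rw [prod_const, card_univ, Fintype.card_coe]

end Literature.MathematicalPhysics.QuantumFieldTheory.BalabanImbrieJaffe1984to88.BIJ88CoupledPairings305
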